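import Literature.AnabelianGeometry.AbsoluteAnabelian.AbsTopIII.CcnSynchronizationBijective
import Literature.AnabelianGeometry.AbsoluteAnabelian.AbsTopIII.FreeProcyclicZHat
import Literature.AnabelianGeometry.AbsoluteAnabelian.ZHatCompletionFreeProcyclic
import HarnessLib

/-!
# [AbsTopIII] Prop. 1.4 (ii): the differential VANISHES on a split extension — so Prop. 1.4 (ii) forces
# `1 → I_x → Δ^{c-cn}_{U_x} → Δ_X → 1` to be non-split, and its universal closure over the interface is refuted

Mochizuki, *Topics in Absolute Anabelian Geometry III*, §1, Prop. 1.4 (ii), manuscript pp. 31–32 (lit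
key `paper:url-5493eb38cbb7`): "applying the differential of the “`E_2`-term” of the Leray spectral
sequence associated to this group extension [...] this last element corresponds to the natural
isomorphism `M_X ⥲ I_x`".  abc-iut-L4-t1 typed the map-level content as the NAMED FACT
`CurveModel.Prop_1_4_ii_transgression M` (FACT-LIST F-0338): for every cyclotome presentation of the
model `M` and every continuous section `s`, the transgression
`d_s : Hom_cont(Ker(Δ^{c-cn}_{U_x} ↠ Δ_X), Ẑ) → H²(Δ_X, Ẑ)` (`ccnTransgression`) is bijective.

This proof-only file (no definitions) records:

* `ContinuousCohomology.transgression_eq_zero_of_map_mul` — GENERIC: for a topological central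
  extension `1 → A → Ẽ → B → 1` and a continuous lift `t` of `φ : G → B` that is MULTIPLICATIVE (a
  splitting), the factor set is trivial and the transgression `Hom_cont(A, Λ) → H²(G, Λ)` is the zero
  map [cite: SerreGaloisCohomology1997, I §2.6 (b)];
* `ccnTransgression_eq_zero_of_map_mul` — hence the differential of Prop. 1.4 (ii) vanishes at a
  multiplicative section of `Δ^{c-cn}_{U_x} ↠ Δ_X`;
* `not_bijective_ccnTransgression_of_map_mul` — for a cuspidally central extension with closed free
  procyclic `I_x` (the data of `IsCyclotomePresentation`), the kernel is `≅ Ẑ ≠ 0`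
  (`kerEquivZHatOfInertia`), so at a multiplicative section the differential is NOT bijective: the
  content of Prop. 1.4 (ii) includes that the cuspidally central extension does not split;
* `CurveModel.not_prop_1_4_ii_transgression_of_split` — a model one of whose cyclotome presentations
  has a split `Δ^{c-cn}_{U_x} ↠ Δ_X` violates `Prop_1_4_ii_transgression`;
* `CurveModel.not_forall_prop_1_4_ii_transgression` — the UNIVERSAL CLOSURE over the interface
  `CurveModel` (no coherence axiom; `CurveModel.lean`) is FALSE: a two-curve toy `U_x ↦ (Ẑ × G ↠ G)`,
  `X ↦ (G = G)` (`G = Gal(ℚ̄/ℚ)`, `Ẑ` = Mathlib's profinite completion of `ℤ`, free procyclic by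
  `isFreeProcyclic_zHatCompletion`) is a cyclotome presentation with `Δ_X = 1`, whose extension splits.
  Hence F-0338 is consumable AT NAMED INSTANCES only (FACT-LIST rule R5).

HONEST FRAMING: statements about the cell's typing (junk instances of an interface) plus one generic
cohomological identity; the printed Prop. 1.4 (ii) (Poincaré duality for the profinite completion of a
surface group: `H²(Δ_X, Ẑ)` free of rank one, generated by the cuspidal extension class) concerns étale
fundamental groups of proper hyperbolic curves, which the tree does not construct, and is not touched;
nothing here bears on [IUTchIII] Cor. 3.12; typed ≠ proved.
-/

noncomputable section

open CategoryTheory TopRep ContRepresentation Topology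

/-! ### Generic: the transgression of a split central extension vanishes -/

namespace ContinuousCohomology

universe v

variable {E B : Type v} [Group E] [TopologicalSpace E] [IsTopologicalGroup E]
  [Group B] [TopologicalSpace B] [IsTopologicalGroup B] (q : E →ₜ* B)
  {G : Type v} [Group G] [TopologicalSpace G] [IsTopologicalGroup G]
  (φ : G →ₜ* B) (t : C(G, E)) (ht : ∀ g, q (t g) = φ g)
  {Λ : Type v} [AddCommGroup Λ] [TopologicalSpace Λ] [IsTopologicalAddGroup Λ]

omit [IsTopologicalGroup E] [IsTopologicalGroup B] [IsTopologicalGroup G] in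
/-- The factor set of a MULTIPLICATIVE lift is trivial: `c(g, h) = t(g) t(h) t(gh)⁻¹ = 1`.
[cite: SerreGaloisCohomology1997, I §2.3] -/
theorem factorSet_eq_one_of_map_mul (hmul : ∀ g h, t (g * h) = t g * t h) (g h : G) :
    factorSet q φ t ht g h = 1 := by
  apply Subtype.ext
  rw [coe_factorSet, hmul, mul_inv_cancel]
  rfl

omit [IsTopologicalGroup B] in
/-- **The transgression of a split central extension is zero**: if the continuous lift `t` of `φ` is
multiplicative, then `Hom_cont(A, Λ) → H²(G, Λ)`, `χ ↦ [χ ∘ c_t]`, vanishes identically (the factor set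
`c_t` is trivial). [cite: SerreGaloisCohomology1997, I §2.6 (b)] -/
theorem transgression_eq_zero_of_map_mul (hA : ∀ a ∈ extKer q, ∀ e : E, e * a = a * e)
    (hmul : ∀ g h, t (g * h) = t g * t h) (χ : Additive (extKer q) →ₜ+ Λ) :
    transgression q φ t ht hA χ = 0 := by
  rw [transgression_apply]
  have h0 : cocycleMkTwo (trivCoeff G Λ) (pushTwoCochain q φ t ht χ)
      (d_pushTwoCochain q φ t ht hA χ) = 0 := by
    apply cocyclesTwo_ext (trivCoeff G Λ)
    rw [iCycles_cocycleMkTwo, map_zero]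
    apply Subtype.ext
    ext x y z
    change pushCochain q φ t ht χ x y z = 0
    rw [pushCochain_apply, factorSet_eq_one_of_map_mul q φ t ht hmul, ofMul_one, map_zero]
  rw [h0, map_zero]

end ContinuousCohomology

namespace Literature.AnabelianGeometry.AbsoluteAnabelian.AbsTopIII

universe u

variable {E F : FundamentalExtension.{u}} (q : E ⟶ F)
variable (Λ : Type u) [AddCommGroup Λ] [TopologicalSpace Λ] [IsTopologicalAddGroup Λ]

/-- **The differential of Prop. 1.4 (ii) vanishes at a multiplicative section**: if the continuous
section `s` of `Δ^{c-cn}_{U_x} ↠ Δ_X` is a homomorphism (the cuspidally central extension SPLITS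
continuously), then `ccnTransgression q Λ s = 0`. [cite: MochizukiAbsTopIII2015, Prop 1.4 (ii) p.31] -/
theorem ccnTransgression_eq_zero_of_map_mul (s : CcnSection q)
    (hs : ∀ a b, s.toFun (a * b) = s.toFun a * s.toFun b) : ccnTransgression q Λ s = 0 :=
  AddMonoidHom.ext fun χ =>
    ContinuousCohomology.transgression_eq_zero_of_map_mul (deltaCcnProjₜ q)
      (ContinuousMonoidHom.id F.geom) s.toFun (fun d => s.proj_apply d) (deltaCcn_central q) hs χ

variable {q} in
/-- **Prop. 1.4 (ii) forces the cuspidally central extension to be NON-SPLIT.**  For a cuspidally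
central extension `1 → I_x → Δ^{c-cn}_{U_x} → Δ_X → 1` (`IsCuspidallyCentralExtension q I`) with `I`
closed and free procyclic ("`I_x ≅ Ẑ(1)`"), the kernel `Ker(Δ^{c-cn}_{U_x} ↠ Δ_X)` is topologically
isomorphic to `Ẑ ≠ 0` (`kerEquivZHatOfInertia`); so at a MULTIPLICATIVE continuous section `s` the
differential `Hom_cont(Ker, Ẑ) → H²(Δ_X, Ẑ)` — the zero map by `ccnTransgression_eq_zero_of_map_mul` —
is not bijective. [cite: MochizukiAbsTopIII2015, Prop 1.4 (ii) p.31] -/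
theorem not_bijective_ccnTransgression_of_map_mul {I : Subgroup E.arith}
    (h : IsCuspidallyCentralExtension q I) (hIc : IsClosed (I : Set E.arith))
    (hI : FundamentalExtension.IsFreeProcyclic I) (s : CcnSection q)
    (hs : ∀ a b, s.toFun (a * b) = s.toFun a * s.toFun b) :
    ¬ Function.Bijective (ccnTransgression q ZHatCoeff.{u} s) := by
  intro hbij
  obtain ⟨e₀⟩ := hI.nonempty_continuousAddEquiv_zhat_of_isClosed hIc
  let e := kerEquivZHatOfInertia h hIc e₀
  -- the zero map is injective, so `Hom_cont(Ker, Ẑ) = 0`; but `kerToZHat e ≠ 0`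
  have hzero : ccnTransgression q ZHatCoeff.{u} s (kerToZHat q e) =
      ccnTransgression q ZHatCoeff.{u} s 0 := by
    rw [ccnTransgression_eq_zero_of_map_mul q ZHatCoeff.{u} s hs]
    rfl
  have hχ : kerToZHat q e = 0 := hbij.1 hzero
  have h1 : (kerToZHat q e) (e.symm 1) = (1 : ZHatCoeff.{u}) := by
    rw [kerToZHat_apply]
    exact e.apply_symm_apply 1
  rw [hχ] at h1
  exact one_ne_zero h1.symm

namespace CurveModel

variable (M : CurveModel.{u})

/-- **A model one of whose cyclotome presentations has a SPLIT cuspidally central extension violates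
`Prop_1_4_ii_transgression`** (the differential vanishes at the multiplicative section while its
domain `Hom_cont(Ker, Ẑ) ≅ Ẑ` is nonzero). [cite: MochizukiAbsTopIII2015, Prop 1.4 (ii) p.31] -/
theorem not_prop_1_4_ii_transgression_of_split {Ux X : M.Curve} (h : M.IsCofiniteOpen Ux X)
    (x : (M.cusps Ux).Cusp) (hp : M.IsCyclotomePresentation h x) (s : CcnSection (M.res h))
    (hs : ∀ a b, s.toFun (a * b) = s.toFun a * s.toFun b) : ¬ M.Prop_1_4_ii_transgression :=
  fun hT => not_bijective_ccnTransgression_of_map_mul hp.isCuspidallyCentral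
    ((M.cusps Ux).isClosed_Icusp x) hp.isFreeProcyclic s hs (hT Ux X h x hp s)

/-- **The universal closure of `CurveModel.Prop_1_4_ii_transgression` is false.**  Witness (a junk
instance of the interface): two curves over `ℚ`, `U_x ↦ (Π := Ẑ × G ↠ G)` and `X ↦ (Π := G = G)` with
`G = Gal(ℚ̄/ℚ)` and `Ẑ` Mathlib's profinite completion of `ℤ` (free procyclic,
`isFreeProcyclic_zHatCompletion`), `res` the second projection, one cusp of `U_x` with decomposition
group `Π_{U_x}` (so `I_x = Δ_{U_x} = Ẑ × 1`).  This is a cyclotome presentation (`Δ_{U_x}` is abelian, so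
`[N, Δ]⁻ = 1`, `Δ^{c-cn}_{U_x} = Δ_{U_x} = I_x`, `Δ_X = 1`), and `Δ^{c-cn}_{U_x} ↠ Δ_X = 1` splits by the
trivial section; by `not_prop_1_4_ii_transgression_of_split` the model violates the schema.  Hence
F-0338 is consumable at NAMED instances only; the printed Prop. 1.4 (ii) is not touched.
[cite: MochizukiAbsTopIII2015, Prop 1.4 (ii) p.31] -/
theorem not_forall_prop_1_4_ii_transgression :
    ¬ ∀ M : CurveModel.{0}, M.Prop_1_4_ii_transgression := by
  intro hall
  -- `Ẑ` (profinite completion of `ℤ`) and `G = G_ℚ`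
  let ZH : ProfiniteGrp.{0} :=
    ProfiniteGrp.ProfiniteCompletion.completion (GrpCat.of (Multiplicative ℤ))
  let Gp : ProfiniteGrp.{0} := absoluteGaloisGrp ℚ
  -- `Π_{U_x} := Ẑ × G ↠ G` and the point extension `Π_X := G`
  let E₁ : FundamentalExtension.{0} :=
    { arith := ProfiniteGrp.of (ZH × Gp), gal := Gp, aug := ContinuousMonoidHom.snd ZH Gp,
      aug_surjective := Prod.snd_surjective }
  let E₀ : FundamentalExtension.{0} :=
    { arith := Gp, gal := Gp, aug := ContinuousMonoidHom.id _,
      aug_surjective := Function.surjective_id }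
  let qq : E₁ ⟶ E₀ := ⟨ContinuousMonoidHom.snd ZH Gp, ContinuousMonoidHom.id _, fun _ => rfl⟩
  let rr : E₀ ⟶ E₁ := ⟨ContinuousMonoidHom.inr ZH Gp, ContinuousMonoidHom.id _, fun _ => rfl⟩
  -- one cusp on `U_x` with decomposition group `Π_{U_x}`; no cusps on `X`
  let C₁ : E₁.CuspidalData :=
    { Cusp := PUnit.{1}
      Dcusp := fun _ => ⊤
      Icusp := fun _ => ⊤ ⊓ E₁.geom
      Icusp_eq := fun _ => rfl
      isClosed_Dcusp := fun _ => by
        rw [Subgroup.coe_top]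
        exact isClosed_univ
      eq_of_conj := fun a b _ _ => Subsingleton.elim a b }
  let C₀ : E₀.CuspidalData :=
    { Cusp := PEmpty.{1}
      Dcusp := fun c => c.elim
      Icusp := fun c => c.elim
      Icusp_eq := fun c => c.elim
      isClosed_Dcusp := fun c => c.elim
      eq_of_conj := fun c => c.elim }
  -- the two-curve model: `false ↦ U_x`, `true ↦ X`
  let ext : ULift.{1, 0} Bool → FundamentalExtension.{0} :=
    fun U => Bool.rec (motive := fun _ => FundamentalExtension.{0}) E₁ E₀ U.down
  let M : CurveModel.{0} :=
    { Curve := ULift.{1, 0} Bool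
      base := fun _ => ℚ
      ext := ext
      galIso := fun U =>
        Bool.rec (motive := fun b => ((ext ⟨b⟩).gal ≅ absoluteGaloisGrp ℚ)) (Iso.refl _) (Iso.refl _)
          U.down
      cusps := fun U => Bool.rec (motive := fun b => (ext ⟨b⟩).CuspidalData) C₁ C₀ U.down
      IsProper := fun U => U.down = true
      IsScheme := fun _ => True
      genus := fun _ => 1
      FunctionField := fun _ => ℚ
      Point := fun _ => PEmpty.{1}
      decomp := fun _ c => c.elim
      IsNFCurve := fun _ => False
      IsNFPoint := fun _ c => c.elim
      IsNFRational := fun _ _ => False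
      IsNFConstant := fun _ _ => False
      NFFunctionField := fun _ => ℚ
      IsStrictlyBelyiType := fun _ => False
      IsCofiniteOpen := fun _ _ => True
      res := fun {U U'} _ =>
        Bool.rec (motive := fun b => (ext ⟨b⟩ ⟶ ext U'))
          (Bool.rec (motive := fun b' => (E₁ ⟶ ext ⟨b'⟩)) (𝟙 E₁) qq U'.down)
          (Bool.rec (motive := fun b' => (E₀ ⟶ ext ⟨b'⟩)) rr (𝟙 E₀) U'.down) U.down }
  have hT : M.Prop_1_4_ii_transgression := hall M
  -- `Δ_{U_x} = Ẑ × 1` is abelian: a dense cyclic subgroup of `Ẑ`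
  obtain ⟨g, hg⟩ := isFreeProcyclic_zHatCompletion.exists_dense_zpowers
  have hcomm : ∀ a ∈ E₁.geom, ∀ b ∈ E₁.geom, a * b = b * a := by
    intro a ha b hb
    have ha' : a.2 = 1 := ha
    have hb' : b.2 = 1 := hb
    exact Prod.ext (mul_comm_of_dense_zpowers hg a.1 b.1) (by
      change a.2 * b.2 = b.2 * a.2
      rw [ha', hb'])
  -- `N = Ker(q) ∩ Δ = Δ`
  have hker : cuspidalKernel qq = E₁.geom := by
    ext a
    change a ∈ qq.arith.toMonoidHom.ker ⊓ E₁.geom ↔ a ∈ E₁.geom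
    rw [Subgroup.mem_inf, MonoidHom.mem_ker]
    exact ⟨fun h => h.2, fun h => ⟨h, h⟩⟩
  -- `[N, Δ]⁻ = 1`
  have hmod : cuspidallyCentralModulus qq = ⊥ := by
    change (⁅cuspidalKernel qq, E₁.geom⁆).topologicalClosure = ⊥
    have hc : ⁅cuspidalKernel qq, E₁.geom⁆ = ⊥ := by
      rw [hker, Subgroup.commutator_eq_bot_iff_le_centralizer]
      intro a ha
      rw [Subgroup.mem_centralizer_iff]
      intro b hb
      exact hcomm b hb a ha
    rw [hc]
    refine le_antisymm (Subgroup.topologicalClosure_minimal ⊥ le_rfl ?_) bot_le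
    rw [Subgroup.coe_bot]
    exact isClosed_singleton
  -- `I_x = Δ_{U_x}`
  have hI : (⊤ ⊓ E₁.geom : Subgroup E₁.arith) = E₁.geom := top_inf_eq E₁.geom
  -- the cyclotome presentation
  have hp : M.IsCyclotomePresentation (Ux := ⟨false⟩) (X := ⟨true⟩) trivial PUnit.unit := by
    refine ⟨⟨trivial, trivial⟩, rfl, ?_, ?_, ?_, ?_⟩
    · -- `x` is rational: `D_x = Π ↠ G`
      intro γ _
      exact ⟨((1 : ZH), γ), Subgroup.mem_top _, rfl⟩
    · -- `I_x = Ẑ × 1 ≅ Ẑ` is free procyclic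
      change FundamentalExtension.IsFreeProcyclic (⊤ ⊓ E₁.geom : Subgroup E₁.arith)
      rw [hI]
      refine isFreeProcyclic_zHatCompletion.of_continuousMulEquiv
        { toFun := fun z => ⟨((z : ZH), (1 : Gp)), (rfl : (1 : Gp) = 1)⟩
          invFun := fun a => (a : E₁.arith).1
          left_inv := fun z => rfl
          right_inv := fun a => by
            apply Subtype.ext
            have ha : (a : E₁.arith).2 = 1 := a.2
            exact Prod.ext rfl ha.symm
          map_mul' := fun z w => rfl
          continuous_toFun := by
            apply Continuous.subtype_mk
            exact continuous_id.prodMk continuous_const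
          continuous_invFun := continuous_fst.comp continuous_subtype_val }
    · -- `N = [I_x]⁻`: `N = Δ = I_x`, normal and closed
      change cuspidalKernel qq = (Subgroup.normalClosure ((⊤ ⊓ E₁.geom : Subgroup E₁.arith) :
        Set E₁.arith)).topologicalClosure
      haveI : E₁.geom.Normal := E₁.normal_geom
      rw [hker, hI, Subgroup.normalClosure_eq_self]
      exact le_antisymm (Subgroup.le_topologicalClosure _)
        (Subgroup.topologicalClosure_minimal _ le_rfl E₁.isClosed_geom)
    · -- `1 → I_x → Δ^{c-cn} → Δ_X → 1` exact: `[N, Δ]⁻ = 1` and `I_x = N`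
      change IsCuspidallyCentralExtension qq (⊤ ⊓ E₁.geom)
      refine ⟨?_, ?_⟩
      · rw [hmod, inf_bot_eq]
      · rw [hmod, sup_bot_eq, hI, hker]
  -- the trivial section of `Δ^{c-cn}_{U_x} ↠ Δ_X = 1` is multiplicative
  let s : CcnSection (M.res (U := ⟨false⟩) (U' := ⟨true⟩) trivial) :=
    { toFun := ContinuousMap.const _ 1
      proj_apply := fun d => by
        rw [ContinuousMap.const_apply, map_one]
        apply Subtype.ext
        have hd : ((d : E₀.arith)) = 1 := d.2
        exact hd.symm }
  have hs : ∀ a b, s.toFun (a * b) = s.toFun a * s.toFun b := fun a b => by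
    change (1 : DeltaCcn qq) = 1 * 1
    rw [mul_one]
  exact M.not_prop_1_4_ii_transgression_of_split (Ux := ⟨false⟩) (X := ⟨true⟩) trivial PUnit.unit hp
    s hs hT

end CurveModel

end Literature.AnabelianGeometry.AbsoluteAnabelian.AbsTopIII
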